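import Summits.QuantumFields.YangMills.Theorems.UnitScaleTiltProp7TrueLinSourcedDefectL1
import Summits.QuantumFields.YangMills.Theorems.UnitScaleTiltProp7LineOfTransportedFamily
import Summits.QuantumFields.YangMills.Theorems.UnitScaleTiltProp7WordCommutatorSplitTranslate
import Literature.MathematicalPhysics.QuantumFieldTheory.Balaban1983to89.BlockAveragingTowerStraightTransportLocal
import Literature.MathematicalPhysics.QuantumFieldTheory.Balaban1983to89.TorusHypercubicSymmetry
import HarnessLib

/-!
# Route `UnitScaleTilt`, crux K1 «MinimiserStabilityRegPr» (stmt-QuantumFields-19200), route-R [RP] curved, row (n3) N3b, file 2d (ii-a), LETTERS —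
# THE COVARIANT TRANSPORT LETTERS FOR THE OSCILLATION ROW OF THE STRAIGHT-LINE MEAN: the straight `ν`-transport of a bond value over `m` steps costs the
# `m` covariant `ν`-differences it crosses (telescoping, `Ad` isometric); re-routing a transport through a closed word `ρ` costs `2·dist1(ρ)`; the three
# closed words met when a coarse bond's line family is translated by `L e_ν` — the correction factor `κ` of (0.4), the LADDER `stair ⧺ ν^L ⧺ rev stair′ ⧺ ν^{−L}`
# (which IS the (0.4) loop variable `loopHol V ⟨y,ν⟩ (r,σ,σ)`), and the `t × L` RECTANGLES (closed words of length `≤ 4L`, lattice Stokes)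

Cell `ym3-torus`, D-0154 (3c) extra-width seat `ym-routeR-w6` (gen 3); LEAD ★p1 g13's NAMED row 2d (ii-a) («LINE-osc», 2026-08-28 13:46Z ∕ 14:02Z) for the
two-channel damped engine ✓∕⧗ `…Prop7TrueLinSourcedOscL1` (`hLINE`).  THEOREMS ONLY (0 `def`, 0 `sorry`); `--supports stmt-QuantumFields-19200`, count-neutral.  YM₃ on
T³ is a ladder rung (R3), not the Clay problem; nothing here claims the stub, the crux, d = 4 or the mass gap.

THE POINT.  The `Λ`-channel of the `ℓ¹` engine must be read in OSCILLATION currency (LEAD's «LOG-TOWER» count); the oscillation functional of record is the `ℓ¹`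
covariant gradient `osc_V(Z) = Σ_bΣ_ν‖V(b₋,ν)Z(b+e_ν)V(b₋,ν)* − Z(b)‖` (✓ A2 `sum_normSq_covGrad_le_mass`'s summand), and the row `osc_{V̄}(LINE_VZ) ≤ L^{2−d}·osc_V(Z) +
leak·‖Z‖_{ℓ¹}` (sequel file) rests on the per-letter transport facts of this file: for the straight-line mean `LINE_VZ(c) = |I|⁻¹Σ_i Ad(V(Γ^σ_{c₋→x_i}))·Z_V([x_i → L e_μ])`
the coarse covariant `ν`-difference `Ad(V̄(c₋,ν))·LINE_VZ(c+e_ν) − LINE_VZ(c)` is, comb by comb, (κ) the correction factor `V̄ = κ·V([emb c₋ → Le_ν])` (tree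
`BlockAveraging.avgFun = corr·axialAvg`), `‖κ − 1‖ ≤ 2a` (✓ `dist1_corr_le_two_mul`); (ladder) `V([emb c₋→Le_ν])·V(Γ(c₋+e_ν)) = ℓ⁻¹·V(Γ(c₋))·V([x_i→Le_ν])` with
`ℓ = loopHol V ⟨c₋,ν⟩ (r,σ,σ)` (✓ `loopHol_eq`), `dist1 ℓ ≤ a`; (rectangles) `V([x→Le_ν])·V([x+Le_ν→te_μ]) = ρ_t·V([x→te_μ])·V([x+te_μ→Le_ν])`, `ρ_t` a closed word of
length `2(L+t)`, `dist1 ρ_t ≤ (L+t)²·a′` (✓ `LatticeWordStokes.dist1_holAt_le`); (telescope) `‖Ad(V([x→me_ν]))Z(x+me_ν,μ) − Z(x,μ)‖ ≤ Σ_{s<m}‖∇^V_νZ(x+se_ν,μ)‖`.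

WHAT IS PROVED (ns `…Theorems.Prop7LineMeanOscLetters`; `SU`-type background of any rank, any `P`, one level `j`).
* §0 `iterate_shift_comm` (✓ `Site.shift_comm` iterated), `norm_ad_sub_ad_le` (re-routing through a closed word), `dist1_holAt_closed_le` (lattice Stokes with a non-strict plaquette bound).
* §1 ★ `norm_transport_sub_le_sum_grad` (telescope = ★routeR-w1's ✓ `norm_sub_transported_translate_le`, re-read).  §2 ★ `holAt_rect_eq`, `norm_ad_rect_sub_le` (rectangles).  §3 ★ `axial_mul_stair_eq` (ladder), `norm_ad_ladder_sub_le`.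
* §4 `norm_ad_corr_sub_le` (κ).
HONEST SCOPE.  Per-letter algebra and the two tree estimates (`dist1_corr_le_two_mul`, `dist1_holAt_le`); no sums over the lattice here (sequel).

References: T. Bałaban, CMP 95 (1984) 17–40 [Balaban1984PropagatorsI] ((1.7), (1.11), (1.18) pp.18–20); CMP 98 (1985) 17–51 [Balaban1985Averaging] ((9) p.19, (19)–(20) p.21,
Prop. 2 (53) p.26); CMP 109 (1987) 249–301 [Balaban1987RG1] ((0.3)–(0.4) pp.252–253).
-/

set_option autoImplicit false

noncomputable section

open scoped BigOperators Matrix.Norms.L2Operator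

namespace Summit.QuantumFields.YangMills.Theorems.Prop7LineMeanOscLetters

open Literature.MathematicalPhysics.QuantumFieldTheory.Balaban1983to89
open Finset T4Continuum BlockAveraging AveragingRT ExpMeanLog BlockAveragingEMLLinearised BlockAveragingEMLLinearisedBackground BlockAveragingEMLProp2
open BlockAveragingTowerStraightTransportLocal (holAt_walk_replicate_true_add walkEnd_replicate_true_eq_iterate)
open Summit.QuantumFields.YangMills.Theorems.Prop7TrueLinReducedStep (norm_sub_conj_le)
open Summit.QuantumFields.YangMills.Theorems.Prop7CovIterLambdaBound (norm_conj_su_le)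
open Summit.QuantumFields.YangMills.Theorems.Prop7HolRatioPerStep (norm_star_sub_one_eq)
open Summit.QuantumFields.YangMills.Theorems.Prop7WordCommutatorSplitTranslate (norm_sub_transported_translate_le)

variable {P : Params} {n : Type*} [Fintype n] [DecidableEq n] [Nonempty n] {j : ℕ}

/-! ## §0 Helpers: commuting iterated shifts, re-routing a transport through a closed word, lattice Stokes with a non-strict bound -/

omit [Fintype n] [DecidableEq n] [Nonempty n] in
/-- Iterated shifts in two directions commute: `(+te_μ) ∘ (+me_ν) = (+me_ν) ∘ (+te_μ)`. [folklore] -/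
theorem iterate_shift_comm (x : Site P j) (μ ν : Fin P.d) (t m : ℕ) :
    (fun z : Site P j => z.shift μ)^[t] ((fun z : Site P j => z.shift ν)^[m] x) = (fun z : Site P j => z.shift ν)^[m] ((fun z : Site P j => z.shift μ)^[t] x) := by
  have h : Function.Commute (fun z : Site P j => z.shift μ) (fun z : Site P j => z.shift ν) := fun z => (Site.shift_comm z ν μ)
  exact (h.iterate_iterate t m) x

/-- **RE-ROUTING A TRANSPORT THROUGH A CLOSED WORD**: if `A = ρ·B` in `SU(N)` then `‖Ad(A)Y − Ad(B)Y‖ ≤ 2·dist1(ρ)·‖Y‖` (`Ad(A)Y = ρ·(Ad(B)Y)·ρ*`, ✓ `norm_sub_conj_le`,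
`Ad(B)` isometric). [cite: Balaban1985Averaging, (19)-(20) p.21] -/
theorem norm_ad_sub_ad_le (A B ρ : Matrix.specialUnitaryGroup n ℂ) (h : A = ρ * B) (Y : Matrix n n ℂ) :
    ‖((A : Matrix.specialUnitaryGroup n ℂ) : Matrix n n ℂ) * Y * star ((A : Matrix.specialUnitaryGroup n ℂ) : Matrix n n ℂ) - ((B : Matrix.specialUnitaryGroup n ℂ) : Matrix n n ℂ) * Y * star ((B : Matrix.specialUnitaryGroup n ℂ) : Matrix n n ℂ)‖ ≤ 2 * dist1 ρ * ‖Y‖ := by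
  have hd : dist1 ρ = ‖((ρ : Matrix.specialUnitaryGroup n ℂ) : Matrix n n ℂ) - 1‖ := rfl
  rw [h, Submonoid.coe_mul, star_mul]
  have e : ((ρ : Matrix.specialUnitaryGroup n ℂ) : Matrix n n ℂ) * ((B : Matrix.specialUnitaryGroup n ℂ) : Matrix n n ℂ) * Y * (star ((B : Matrix.specialUnitaryGroup n ℂ) : Matrix n n ℂ) * star ((ρ : Matrix.specialUnitaryGroup n ℂ) : Matrix n n ℂ)) - ((B : Matrix.specialUnitaryGroup n ℂ) : Matrix n n ℂ) * Y * star ((B : Matrix.specialUnitaryGroup n ℂ) : Matrix n n ℂ)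
      = -((((B : Matrix.specialUnitaryGroup n ℂ) : Matrix n n ℂ) * Y * star ((B : Matrix.specialUnitaryGroup n ℂ) : Matrix n n ℂ)) - ((ρ : Matrix.specialUnitaryGroup n ℂ) : Matrix n n ℂ) * (((B : Matrix.specialUnitaryGroup n ℂ) : Matrix n n ℂ) * Y * star ((B : Matrix.specialUnitaryGroup n ℂ) : Matrix n n ℂ)) * star ((ρ : Matrix.specialUnitaryGroup n ℂ) : Matrix n n ℂ)) := by noncomm_ring
  rw [e, norm_neg, hd]
  exact (norm_sub_conj_le ρ _).trans (mul_le_mul_of_nonneg_left (norm_conj_su_le B Y) (by positivity))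

/-- **LATTICE STOKES WITH A NON-STRICT PLAQUETTE BOUND**: if every plaquette variable of `V` is within `a′` of `1` (`≤`), then every closed word `w` has
`dist1 (V(walk_x w)) ≤ (|w|²/4)·a′` (✓ `LatticeWordStokes.dist1_holAt_le` at every `δ > a′`). [cite: Balaban1985Averaging, (9) p.19] -/
theorem dist1_holAt_closed_le (V : GaugeField P j (Matrix.specialUnitaryGroup n ℂ)) {a' : ℝ} (ha' : 0 ≤ a') (hV : ∀ q : Plaq P j, dist1 (GaugeField.plaqHol V q) ≤ a')
    (w : List (Letter P.d)) (hw : ∀ ν, netDisp w ν = 0) (x : Site P j) :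
    dist1 (holAt V (walk x w)) ≤ ((w.length : ℝ) ^ 2 / 4) * a' := by
  refine le_of_forall_pos_le_add fun ε hε => ?_
  have hlen : (0 : ℝ) ≤ (w.length : ℝ) ^ 2 / 4 := by positivity
  have hP : PlaqSmall (a' + ε / ((w.length : ℝ) ^ 2 / 4 + 1)) V := fun q => (hV q).trans_lt (lt_add_of_pos_right _ (by positivity))
  have h := LatticeWordStokes.dist1_holAt_le V (by positivity) hP w hw x
  have hε' : ((w.length : ℝ) ^ 2 / 4) * (ε / ((w.length : ℝ) ^ 2 / 4 + 1)) ≤ ε := by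
    rw [mul_div_assoc']
    rw [div_le_iff₀ (by positivity)]
    nlinarith
  calc dist1 (holAt V (walk x w)) ≤ ((w.length : ℝ) ^ 2 / 4) * (a' + ε / ((w.length : ℝ) ^ 2 / 4 + 1)) := h
    _ = ((w.length : ℝ) ^ 2 / 4) * a' + ((w.length : ℝ) ^ 2 / 4) * (ε / ((w.length : ℝ) ^ 2 / 4 + 1)) := by ring
    _ ≤ ((w.length : ℝ) ^ 2 / 4) * a' + ε := add_le_add le_rfl hε'

/-! ## §1 ★ The telescope: straight `ν`-transport of a bond value costs the covariant `ν`-differences it crosses -/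

/-- ★ **THE TELESCOPE** (★routeR-w1 g3's ✓ `Prop7WordCommutatorSplitTranslate.norm_sub_transported_translate_le`, read with the roles of the two directions exchanged and
the difference reversed): `‖V([x→me_ν])·Z(x + me_ν, μ)·V([x→me_ν])* − Z(x, μ)‖ ≤ Σ_{s<m}‖V(x+se_ν, ν)·Z(x+(s+1)e_ν, μ)·V(x+se_ν, ν)* − Z(x+se_ν, μ)‖` — the straight transport over
`m` steps against the `m` covariant `ν`-differences of ✓ A2's oscillation letter. [cite: Balaban1984PropagatorsI, (1.7), (1.18) pp.18-20] -/
theorem norm_transport_sub_le_sum_grad (V : GaugeField P j (Matrix.specialUnitaryGroup n ℂ)) (Z : PBond P j → Matrix n n ℂ) (x : Site P j) (μ ν : Fin P.d) (m : ℕ) :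
    ‖((holAt V (walk x (List.replicate m (ν, true))) : Matrix.specialUnitaryGroup n ℂ) : Matrix n n ℂ) * Z ⟨((fun z : Site P j => z.shift ν)^[m] x), μ⟩ * star ((holAt V (walk x (List.replicate m (ν, true))) : Matrix.specialUnitaryGroup n ℂ) : Matrix n n ℂ) - Z ⟨x, μ⟩‖
      ≤ ∑ s ∈ Finset.range m, ‖(((V ⟨((fun z : Site P j => z.shift ν)^[s] x), ν⟩ : Matrix.specialUnitaryGroup n ℂ) : Matrix n n ℂ) * Z ⟨Site.shift (((fun z : Site P j => z.shift ν)^[s] x)) ν, μ⟩ * star ((V ⟨((fun z : Site P j => z.shift ν)^[s] x), ν⟩ : Matrix.specialUnitaryGroup n ℂ) : Matrix n n ℂ) - Z ⟨((fun z : Site P j => z.shift ν)^[s] x), μ⟩)‖ := by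
  rw [norm_sub_rev]
  exact norm_sub_transported_translate_le V Z x ν μ m

/-! ## §2 ★ The rectangles: re-routing `[x → Le_ν → te_μ]` through `[x → te_μ → Le_ν]` -/

/-- The closed rectangle word `ν^m μ^t ν^{−m} μ^{−t}` has zero net displacement. [folklore] -/
theorem netDisp_rect (μ ν : Fin P.d) (t m : ℕ) (κ : Fin P.d) :
    netDisp (List.replicate m (ν, true) ++ (List.replicate t (μ, true) ++ (List.replicate m (ν, false) ++ List.replicate t (μ, false)))) κ = 0 := by
  simp only [T4ReflectionCone.netDisp_append, T4ReflectionCone.netDisp_replicate]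
  by_cases h1 : ν = κ <;> by_cases h2 : μ = κ <;> simp [h1, h2]

/-- ★ **THE RECTANGLE HOLONOMY FACTORISED**: `V(ν^m μ^t ν^{−m} μ^{−t} from x) = V([x→me_ν])·V([x+me_ν→te_μ])·V([x+te_μ→me_ν])⁻¹·V([x→te_μ])⁻¹`.
[cite: Balaban1985Averaging, (9) p.19] -/
theorem holAt_rect_eq (V : GaugeField P j (Matrix.specialUnitaryGroup n ℂ)) (x : Site P j) (μ ν : Fin P.d) (t m : ℕ) :
    holAt V (walk x (List.replicate m (ν, true) ++ (List.replicate t (μ, true) ++ (List.replicate m (ν, false) ++ List.replicate t (μ, false)))))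
      = holAt V (walk x (List.replicate m (ν, true))) * holAt V (walk ((fun z : Site P j => z.shift ν)^[m] x) (List.replicate t (μ, true)))
        * (holAt V (walk ((fun z : Site P j => z.shift μ)^[t] x) (List.replicate m (ν, true))))⁻¹ * (holAt V (walk x (List.replicate t (μ, true))))⁻¹ := by
  rw [walk_append, holAt_append, walkEnd_replicate_true_eq_iterate, walk_append, holAt_append, walkEnd_replicate_true_eq_iterate,
    walk_append, holAt_append]
  -- the two backward runs are reversed forward runs
  have h3w : List.replicate m (ν, false) = wordRev (List.replicate m (ν, true)) := by rw [wordRev_replicate]; rfl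
  have h4w : List.replicate t (μ, false) = wordRev (List.replicate t (μ, true)) := by rw [wordRev_replicate]; rfl
  have hcorner : ((fun z : Site P j => z.shift μ)^[t] ((fun z : Site P j => z.shift ν)^[m] x)) = walkEnd ((fun z : Site P j => z.shift μ)^[t] x) (List.replicate m (ν, true)) := by
    rw [walkEnd_replicate_true_eq_iterate, iterate_shift_comm]
  have h3 : holAt V (walk ((fun z : Site P j => z.shift μ)^[t] ((fun z : Site P j => z.shift ν)^[m] x)) (List.replicate m (ν, false))) = (holAt V (walk ((fun z : Site P j => z.shift μ)^[t] x) (List.replicate m (ν, true))))⁻¹ := by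
    rw [hcorner, h3w, holAt_walk_wordRev]
  have hend3 : walkEnd ((fun z : Site P j => z.shift μ)^[t] ((fun z : Site P j => z.shift ν)^[m] x)) (List.replicate m (ν, false)) = ((fun z : Site P j => z.shift μ)^[t] x) := by
    rw [hcorner, h3w, walkEnd_walkEnd_wordRev]
  have h4 : holAt V (walk ((fun z : Site P j => z.shift μ)^[t] x) (List.replicate t (μ, false))) = (holAt V (walk x (List.replicate t (μ, true))))⁻¹ := by
    rw [show ((fun z : Site P j => z.shift μ)^[t] x) = walkEnd x (List.replicate t (μ, true)) from (walkEnd_replicate_true_eq_iterate μ t x).symm, h4w,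
      holAt_walk_wordRev]
  rw [h3, hend3, h4, mul_assoc, mul_assoc]

/-- ★ **RE-ROUTING THROUGH A RECTANGLE**: with all plaquette variables of `V` within `a′` of `1`,
`‖Ad(V([x→me_ν])·V([x+me_ν→te_μ]))Y − Ad(V([x→te_μ])·V([x+te_μ→me_ν]))Y‖ ≤ 2·(m+t)²·a′·‖Y‖` (the rectangle is a closed word of length `2(m+t)`; §0).
[cite: Balaban1985Averaging, (9) p.19, (19)-(20) p.21] -/
theorem norm_ad_rect_sub_le (V : GaugeField P j (Matrix.specialUnitaryGroup n ℂ)) {a' : ℝ} (ha' : 0 ≤ a') (hV : ∀ q : Plaq P j, dist1 (GaugeField.plaqHol V q) ≤ a')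
    (x : Site P j) (μ ν : Fin P.d) (t m : ℕ) (Y : Matrix n n ℂ) :
    ‖((holAt V (walk x (List.replicate m (ν, true))) * holAt V (walk ((fun z : Site P j => z.shift ν)^[m] x) (List.replicate t (μ, true))) : Matrix.specialUnitaryGroup n ℂ) : Matrix n n ℂ) * Y * star ((holAt V (walk x (List.replicate m (ν, true))) * holAt V (walk ((fun z : Site P j => z.shift ν)^[m] x) (List.replicate t (μ, true))) : Matrix.specialUnitaryGroup n ℂ) : Matrix n n ℂ)
        - ((holAt V (walk x (List.replicate t (μ, true))) * holAt V (walk ((fun z : Site P j => z.shift μ)^[t] x) (List.replicate m (ν, true))) : Matrix.specialUnitaryGroup n ℂ) : Matrix n n ℂ) * Y * star ((holAt V (walk x (List.replicate t (μ, true))) * holAt V (walk ((fun z : Site P j => z.shift μ)^[t] x) (List.replicate m (ν, true))) : Matrix.specialUnitaryGroup n ℂ) : Matrix n n ℂ)‖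
      ≤ 2 * (((m : ℝ) + t) ^ 2 * a') * ‖Y‖ := by
  set ρ := holAt V (walk x (List.replicate m (ν, true) ++ (List.replicate t (μ, true) ++ (List.replicate m (ν, false) ++ List.replicate t (μ, false))))) with hρ
  have hfac : holAt V (walk x (List.replicate m (ν, true))) * holAt V (walk ((fun z : Site P j => z.shift ν)^[m] x) (List.replicate t (μ, true)))
      = ρ * (holAt V (walk x (List.replicate t (μ, true))) * holAt V (walk ((fun z : Site P j => z.shift μ)^[t] x) (List.replicate m (ν, true)))) := by
    rw [hρ, holAt_rect_eq]; group
  have hd : dist1 ρ ≤ ((m : ℝ) + t) ^ 2 * a' := by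
    have h := dist1_holAt_closed_le V ha' hV _ (netDisp_rect μ ν t m) x
    have hlen : (((List.replicate m (ν, true) ++ (List.replicate t (μ, true) ++ (List.replicate m (ν, false) ++ List.replicate t (μ, false)))).length : ℕ) : ℝ)
        = 2 * ((m : ℝ) + t) := by
      simp only [List.length_append, List.length_replicate]; push_cast; ring
    rw [hlen] at h
    calc dist1 ρ ≤ ((2 * ((m : ℝ) + t)) ^ 2 / 4) * a' := h
      _ = ((m : ℝ) + t) ^ 2 * a' := by ring
  exact (norm_ad_sub_ad_le _ _ ρ hfac Y).trans (mul_le_mul_of_nonneg_right (mul_le_mul_of_nonneg_left hd (by norm_num)) (norm_nonneg _))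

/-! ## §3 ★ The ladder: it is the (0.4) loop variable -/

/-- ★ **THE LADDER IS THE (0.4) LOOP VARIABLE**: at the coarse bond `⟨y, ν⟩` with comb index `(r, σ, σ)`,
`U(⟨y,ν⟩)·V(Γ^σ_{y+e_ν → x′}) = (loopHol V ⟨y,ν⟩ (r,σ,σ))⁻¹·V(Γ^σ_{y → x})·V([x → Le_ν])` (`U(c) = axialAvg`, ✓ `loopHol_eq`). [cite: Balaban1987RG1, (0.4) p.253] -/
theorem axial_mul_stair_eq (V : GaugeField P j (Matrix.specialUnitaryGroup n ℂ)) (y : Site P (j + 1)) (ν : Fin P.d) (r : Fin P.d → Fin P.L) (σ : Equiv.Perm (Fin P.d)) :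
    axialAvg V ⟨y, ν⟩ * holAt V (walk (emb (y.shift ν)) (stairWord σ (off r)))
      = (loopHol V ⟨y, ν⟩ (r, σ, σ))⁻¹ * (holAt V (walk (emb y) (stairWord σ (off r)))
          * holAt V (walk (walkEnd (emb y) (stairWord σ (off r))) (List.replicate P.L (ν, true)))) := by
  rw [loopHol_eq]
  simp only [show (⟨y, ν⟩ : PBond P (j + 1)).tgt = y.shift ν from rfl]
  group

/-- ★ **RE-ROUTING THROUGH THE LADDER** costs the loop variable: `‖Ad(U(⟨y,ν⟩)·V(Γ(y+e_ν)))Y − Ad(V(Γ(y))·V([x→Le_ν]))Y‖ ≤ 2·dist1(loopHol V ⟨y,ν⟩ (r,σ,σ))·‖Y‖`.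
[cite: Balaban1987RG1, (0.4) p.253; Balaban1985Averaging, (19)-(20) p.21] -/
theorem norm_ad_ladder_sub_le (V : GaugeField P j (Matrix.specialUnitaryGroup n ℂ)) (y : Site P (j + 1)) (ν : Fin P.d) (r : Fin P.d → Fin P.L) (σ : Equiv.Perm (Fin P.d))
    (Y : Matrix n n ℂ) :
    ‖((axialAvg V ⟨y, ν⟩ * holAt V (walk (emb (y.shift ν)) (stairWord σ (off r))) : Matrix.specialUnitaryGroup n ℂ) : Matrix n n ℂ) * Y
          * star ((axialAvg V ⟨y, ν⟩ * holAt V (walk (emb (y.shift ν)) (stairWord σ (off r))) : Matrix.specialUnitaryGroup n ℂ) : Matrix n n ℂ)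
        - ((holAt V (walk (emb y) (stairWord σ (off r))) * holAt V (walk (walkEnd (emb y) (stairWord σ (off r))) (List.replicate P.L (ν, true))) : Matrix.specialUnitaryGroup n ℂ) : Matrix n n ℂ) * Y
          * star ((holAt V (walk (emb y) (stairWord σ (off r))) * holAt V (walk (walkEnd (emb y) (stairWord σ (off r))) (List.replicate P.L (ν, true))) : Matrix.specialUnitaryGroup n ℂ) : Matrix n n ℂ)‖
      ≤ 2 * dist1 (loopHol V ⟨y, ν⟩ (r, σ, σ)) * ‖Y‖ := by
  have h := norm_ad_sub_ad_le _ _ _ (axial_mul_stair_eq V y ν r σ) Y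
  rwa [GaugeGroup.dist1_inv] at h

/-! ## §4 The correction factor of (0.4) -/

/-- **RE-ROUTING THROUGH THE CORRECTION FACTOR**: `Ū(c) = κ(c)·U(c)` (tree `BlockAveraging.avgFun = corr·axialAvg`); if the (0.4) loop variables at `c` are within
`a ≤ 1/6`, `a < δ_N` of `1`, then `‖Ad(Ū(c))X − Ad(U(c))X‖ ≤ 4a·‖X‖` (✓ `dist1_corr_le_two_mul`). [cite: Balaban1987RG1, (0.4) p.253; Balaban1985Averaging, Prop. 2 (53) p.26] -/
theorem norm_ad_corr_sub_le (V : GaugeField P j (Matrix.specialUnitaryGroup n ℂ)) (c : PBond P (j + 1)) {a : ℝ}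
    (hα : ∀ i : Idx P, dist1 (loopHol V c i) ≤ a) (haN : a < deltaSU n) (ha6 : a ≤ 1 / 6) (X : Matrix n n ℂ) :
    ‖((avgFun (expMeanLogSU (n := n)) V c : Matrix.specialUnitaryGroup n ℂ) : Matrix n n ℂ) * X * star ((avgFun (expMeanLogSU (n := n)) V c : Matrix.specialUnitaryGroup n ℂ) : Matrix n n ℂ)
        - ((axialAvg V c : Matrix.specialUnitaryGroup n ℂ) : Matrix n n ℂ) * X * star ((axialAvg V c : Matrix.specialUnitaryGroup n ℂ) : Matrix n n ℂ)‖ ≤ 2 * (2 * a) * ‖X‖ := by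
  have h := norm_ad_sub_ad_le (avgFun (expMeanLogSU (n := n)) V c) (axialAvg V c) (corr (expMeanLogSU (n := n)) V c) rfl X
  exact h.trans (mul_le_mul_of_nonneg_right (mul_le_mul_of_nonneg_left (dist1_corr_le_two_mul V c hα haN ha6) (by norm_num)) (norm_nonneg _))

/-! ## §5 ★★ The coarse covariant `ν`-difference of ONE comb term of the straight-line mean -/

omit [Fintype n] [DecidableEq n] [Nonempty n] in
/-- The block site of offsets `r` in the block of `y + e_ν` is the `L`-fold `ν`-shift of the one in the block of `y` (staircases from the two centres end `L e_ν`
apart, ✓ `walkEnd_stairWord_shift`). [cite: Balaban1987RG1, (0.3) p.252] -/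
theorem blockSite_shift_eq_iterate (y : Site P (j + 1)) (ν : Fin P.d) (r : Fin P.d → Fin P.L) :
    Site.blockSite (y.shift ν) r = (fun z : Site P j => z.shift ν)^[P.L] (Site.blockSite y r) := by
  rw [← walkEnd_emb_stairWord_eq_blockSite (y.shift ν) 1 r, ← walkEnd_emb_stairWord_eq_blockSite y 1 r,
    walkEnd_stairWord_shift y ν 1 1 (off r), ← walkEnd_replicate_true, walkEnd_replicate_true_eq_iterate]

omit [Nonempty n] in
/-- `Ad` of a product is the composition of the `Ad`s. [folklore] -/
theorem ad_mul (A B : Matrix.specialUnitaryGroup n ℂ) (Y : Matrix n n ℂ) :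
    ((A * B : Matrix.specialUnitaryGroup n ℂ) : Matrix n n ℂ) * Y * star ((A * B : Matrix.specialUnitaryGroup n ℂ) : Matrix n n ℂ) = ((A : Matrix.specialUnitaryGroup n ℂ) : Matrix n n ℂ) * (((B : Matrix.specialUnitaryGroup n ℂ) : Matrix n n ℂ) * Y * star ((B : Matrix.specialUnitaryGroup n ℂ) : Matrix n n ℂ)) * star ((A : Matrix.specialUnitaryGroup n ℂ) : Matrix n n ℂ) := by
  rw [Submonoid.coe_mul, star_mul]; noncomm_ring

omit [Nonempty n] in
/-- `Ad(A)` is additive∕subtractive in its argument. [folklore] -/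
theorem ad_sub (A : Matrix.specialUnitaryGroup n ℂ) (Y Y' : Matrix n n ℂ) :
    ((A : Matrix.specialUnitaryGroup n ℂ) : Matrix n n ℂ) * Y * star ((A : Matrix.specialUnitaryGroup n ℂ) : Matrix n n ℂ) - ((A : Matrix.specialUnitaryGroup n ℂ) : Matrix n n ℂ) * Y' * star ((A : Matrix.specialUnitaryGroup n ℂ) : Matrix n n ℂ) = ((A : Matrix.specialUnitaryGroup n ℂ) : Matrix n n ℂ) * (Y - Y') * star ((A : Matrix.specialUnitaryGroup n ℂ) : Matrix n n ℂ) := by noncomm_ring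

/-- ★★ **THE COARSE COVARIANT `ν`-DIFFERENCE OF ONE COMB TERM OF `LINE_V`.**  Coarse bond `c`, transverse (or equal) direction `ν`, comb offsets `r`, order `σ`;
`x_r = blockSite c₋ r`, `x_r′ = blockSite (c₋+e_ν) r = x_r + Le_ν`; the comb term of `LINE_VZ(c)` is `Ad(V(Γ^σ_{c₋→x_r}))·Z_V([x_r → Le_μ])`, that of `LINE_VZ(c+e_ν)`
the same from `c₋ + e_ν`.  If the (0.4) loop variables at the coarse bond `⟨c₋, ν⟩` are within `a ≤ 1/6`, `a < δ_N` of `1` and the plaquette variables within `a′`, then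
`‖Ad(Ū(c₋,ν))(comb term of c+e_ν) − (comb term of c)‖ ≤ Σ_{t<L}Σ_{s<L}‖∇^V_νZ(x_r + te_μ + se_ν, μ)‖ + (6a + 8L²a′)·Σ_{t<L}‖Z(x_r′ + te_μ, μ)‖`
(κ: `4a`; ladder: `2a`; one `t × L` rectangle per line bond: `8L²a′`; telescope: the double sum).
[cite: Balaban1984PropagatorsI, (1.11), (1.18) pp.19-20; Balaban1985Averaging, (9) p.19, Prop. 3 (125) p.36; Balaban1987RG1, (0.3)-(0.4) pp.252-253] -/
theorem norm_coarseDiff_combTerm_le (V : GaugeField P j (Matrix.specialUnitaryGroup n ℂ)) (Z : PBond P j → Matrix n n ℂ) (c : PBond P (j + 1)) (ν : Fin P.d)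
    (r : Fin P.d → Fin P.L) (σ : Equiv.Perm (Fin P.d)) {a a' : ℝ} (ha0 : 0 ≤ a)
    (hα : ∀ i : Idx P, dist1 (loopHol V ⟨c.src, ν⟩ i) ≤ a) (haN : a < deltaSU n) (ha6 : a ≤ 1 / 6)
    (ha' : 0 ≤ a') (hV : ∀ q : Plaq P j, dist1 (GaugeField.plaqHol V q) ≤ a') :
    ‖((avgFun (expMeanLogSU (n := n)) V ⟨c.src, ν⟩ : Matrix.specialUnitaryGroup n ℂ) : Matrix n n ℂ) * (((holAt V (walk (emb (c.src.shift ν)) (stairWord σ (off r))) : Matrix.specialUnitaryGroup n ℂ) : Matrix n n ℂ) * covWalkSum V Z (walk (walkEnd (emb (c.src.shift ν)) (stairWord σ (off r))) (List.replicate P.L (c.dir, true))) * star ((holAt V (walk (emb (c.src.shift ν)) (stairWord σ (off r))) : Matrix.specialUnitaryGroup n ℂ) : Matrix n n ℂ)) * star ((avgFun (expMeanLogSU (n := n)) V ⟨c.src, ν⟩ : Matrix.specialUnitaryGroup n ℂ) : Matrix n n ℂ)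
        - ((holAt V (walk (emb c.src) (stairWord σ (off r))) : Matrix.specialUnitaryGroup n ℂ) : Matrix n n ℂ) * covWalkSum V Z (walk (walkEnd (emb c.src) (stairWord σ (off r))) (List.replicate P.L (c.dir, true))) * star ((holAt V (walk (emb c.src) (stairWord σ (off r))) : Matrix.specialUnitaryGroup n ℂ) : Matrix n n ℂ)‖
      ≤ ∑ t ∈ Finset.range P.L, ∑ s ∈ Finset.range P.L, ‖(((V ⟨((fun z : Site P j => z.shift ν)^[s] ((fun z : Site P j => z.shift c.dir)^[t] (Site.blockSite c.src r))), ν⟩ : Matrix.specialUnitaryGroup n ℂ) : Matrix n n ℂ) * Z ⟨Site.shift (((fun z : Site P j => z.shift ν)^[s] ((fun z : Site P j => z.shift c.dir)^[t] (Site.blockSite c.src r)))) ν, c.dir⟩ * star ((V ⟨((fun z : Site P j => z.shift ν)^[s] ((fun z : Site P j => z.shift c.dir)^[t] (Site.blockSite c.src r))), ν⟩ : Matrix.specialUnitaryGroup n ℂ) : Matrix n n ℂ) - Z ⟨((fun z : Site P j => z.shift ν)^[s] ((fun z : Site P j => z.shift c.dir)^[t] (Site.blockSite c.src r))), c.dir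⟩)‖
        + (6 * a + 8 * (P.L : ℝ) ^ 2 * a') * ∑ t ∈ Finset.range P.L, ‖Z ⟨((fun z : Site P j => z.shift c.dir)^[t] (Site.blockSite (c.src.shift ν) r)), c.dir⟩‖ := by
  -- where the staircases end
  have hx : walkEnd (emb c.src) (stairWord σ (off r)) = (Site.blockSite c.src r) := walkEnd_emb_stairWord_eq_blockSite c.src σ r
  have hbs : (Site.blockSite (c.src.shift ν) r) = ((fun z : Site P j => z.shift ν)^[P.L] (Site.blockSite c.src r)) := blockSite_shift_eq_iterate c.src ν r
  have hx' : walkEnd (emb (c.src.shift ν)) (stairWord σ (off r)) = ((fun z : Site P j => z.shift ν)^[P.L] (Site.blockSite c.src r)) := by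
    rw [walkEnd_emb_stairWord_eq_blockSite, hbs]
  rw [hx, hx', hbs]
  have hax : axialAvg V ⟨c.src, ν⟩ = holAt V (walk (emb c.src) (List.replicate P.L (ν, true))) := axialAvg_eq_holAt_walk V ⟨c.src, ν⟩
  -- the mass of the translated segment
  have hmassS' : ‖(covWalkSum V Z (walk ((fun z : Site P j => z.shift ν)^[P.L] (Site.blockSite c.src r)) (List.replicate P.L (c.dir, true))))‖ ≤ ∑ t ∈ Finset.range P.L, ‖Z ⟨((fun z : Site P j => z.shift c.dir)^[t] ((fun z : Site P j => z.shift ν)^[P.L] (Site.blockSite c.src r))), c.dir⟩‖ := by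
    rw [Prop7LineOfTransportedFamily.covWalkSum_walk_replicate_true]
    exact (norm_sum_le _ _).trans (Finset.sum_le_sum fun t _ => norm_conj_su_le _ _)
  have hmass0 : 0 ≤ ∑ t ∈ Finset.range P.L, ‖Z ⟨((fun z : Site P j => z.shift c.dir)^[t] ((fun z : Site P j => z.shift ν)^[P.L] (Site.blockSite c.src r))), c.dir⟩‖ := Finset.sum_nonneg fun t _ => norm_nonneg _
  -- (κ) the correction factor
  have h1 : ‖((avgFun (expMeanLogSU (n := n)) V ⟨c.src, ν⟩ : Matrix.specialUnitaryGroup n ℂ) : Matrix n n ℂ) * ((((holAt V (walk (emb (c.src.shift ν)) (stairWord σ (off r)))) : Matrix.specialUnitaryGroup n ℂ) : Matrix n n ℂ) * (covWalkSum V Z (walk ((fun z : Site P j => z.shift ν)^[P.L] (Site.blockSite c.src r)) (List.replicate P.L (c.dir, true)))) * star (((holAt V (walk (emb (c.src.shift ν)) (stairWord σ (off r)))) : Matrix.specialUnitaryGroup n ℂ) : Matrix n n ℂ)) * star ((avgFun (expMeanLogSU (n := n)) V ⟨c.src, ν⟩ : Matrix.specialUnitaryGroup n ℂ) : Matrix n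 n ℂ)
      - (((holAt V (walk (emb c.src) (List.replicate P.L (ν, true)))) : Matrix.specialUnitaryGroup n ℂ) : Matrix n n ℂ) * ((((holAt V (walk (emb (c.src.shift ν)) (stairWord σ (off r)))) : Matrix.specialUnitaryGroup n ℂ) : Matrix n n ℂ) * (covWalkSum V Z (walk ((fun z : Site P j => z.shift ν)^[P.L] (Site.blockSite c.src r)) (List.replicate P.L (c.dir, true)))) * star (((holAt V (walk (emb (c.src.shift ν)) (stairWord σ (off r)))) : Matrix.specialUnitaryGroup n ℂ) : Matrix n n ℂ)) * star (((holAt V (walk (emb c.src) (List.replicate P.L (ν, true)))) : Matrix.specialUnitaryGroup n ℂ) : Matrix n n ℂ)‖ ≤ 2 * (2 * a) * ‖(covWalkSum V Z (walk ((fun z : Site P j => z.shift ν)^[P.L] (Site.blockSite c.src r)) (List.replicate P.L (c.dir, true))))‖ := by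
    have h := norm_ad_corr_sub_le V ⟨c.src, ν⟩ hα haN ha6 ((((holAt V (walk (emb (c.src.shift ν)) (stairWord σ (off r)))) : Matrix.specialUnitaryGroup n ℂ) : Matrix n n ℂ) * (covWalkSum V Z (walk ((fun z : Site P j => z.shift ν)^[P.L] (Site.blockSite c.src r)) (List.replicate P.L (c.dir, true)))) * star (((holAt V (walk (emb (c.src.shift ν)) (stairWord σ (off r)))) : Matrix.specialUnitaryGroup n ℂ) : Matrix n n ℂ))
    rw [hax] at h
    exact h.trans (mul_le_mul_of_nonneg_left (norm_conj_su_le _ _) (by positivity))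
  -- (ladder) the (0.4) loop variable
  have h2 : ‖(((holAt V (walk (emb c.src) (List.replicate P.L (ν, true)))) : Matrix.specialUnitaryGroup n ℂ) : Matrix n n ℂ) * ((((holAt V (walk (emb (c.src.shift ν)) (stairWord σ (off r)))) : Matrix.specialUnitaryGroup n ℂ) : Matrix n n ℂ) * (covWalkSum V Z (walk ((fun z : Site P j => z.shift ν)^[P.L] (Site.blockSite c.src r)) (List.replicate P.L (c.dir, true)))) * star (((holAt V (walk (emb (c.src.shift ν)) (stairWord σ (off r)))) : Matrix.specialUnitaryGroup n ℂ) : Matrix n n ℂ)) * star (((holAt V (walk (emb c.src) (List.replicate P.L (ν, true)))) : Matrix.specialUnitaryGroup n ℂ) : Matrix n n ℂ)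
      - (((holAt V (walk (emb c.src) (stairWord σ (off r)))) : Matrix.specialUnitaryGroup n ℂ) : Matrix n n ℂ) * ((((holAt V (walk (Site.blockSite c.src r) (List.replicate P.L (ν, true)))) : Matrix.specialUnitaryGroup n ℂ) : Matrix n n ℂ) * (covWalkSum V Z (walk ((fun z : Site P j => z.shift ν)^[P.L] (Site.blockSite c.src r)) (List.replicate P.L (c.dir, true)))) * star (((holAt V (walk (Site.blockSite c.src r) (List.replicate P.L (ν, true)))) : Matrix.specialUnitaryGroup n ℂ) : Matrix n n ℂ)) * star (((holAt V (walk (emb c.src) (stairWord σ (off r)))) : Matrix.specialUnitaryGroup n ℂ) : Matrix n n ℂ)‖ ≤ 2 * a * ‖(covWalkSum V Z (walk ((fun z : Site P j => z.shift ν)^[P.L] (Site.blockSite c.src r)) (List.replicate P.L (c.dir, true))))‖ := by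
    have h := norm_ad_ladder_sub_le V c.src ν r σ (covWalkSum V Z (walk ((fun z : Site P j => z.shift ν)^[P.L] (Site.blockSite c.src r)) (List.replicate P.L (c.dir, true))))
    rw [hx, hax, ad_mul, ad_mul] at h
    exact h.trans (mul_le_mul_of_nonneg_right (mul_le_mul_of_nonneg_left (hα (r, σ, σ)) (by norm_num)) (norm_nonneg _))
  -- (main) transport of the translated segment back, bond by bond
  have h3 : ‖(((holAt V (walk (Site.blockSite c.src r) (List.replicate P.L (ν, true)))) : Matrix.specialUnitaryGroup n ℂ) : Matrix n n ℂ) * (covWalkSum V Z (walk ((fun z : Site P j => z.shift ν)^[P.L] (Site.blockSite c.src r)) (List.replicate P.L (c.dir, true)))) * star (((holAt V (walk (Site.blockSite c.src r) (List.replicate P.L (ν, true)))) : Matrix.specialUnitaryGroup n ℂ) : Matrix n n ℂ) - (covWalkSum V Z (walk (Site.blockSite c.src r) (List.replicate P.L (c.dir, true))))‖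
      ≤ ∑ t ∈ Finset.range P.L, (∑ s ∈ Finset.range P.L, ‖(((V ⟨((fun z : Site P j => z.shift ν)^[s] ((fun z : Site P j => z.shift c.dir)^[t] (Site.blockSite c.src r))), ν⟩ : Matrix.specialUnitaryGroup n ℂ) : Matrix n n ℂ) * Z ⟨Site.shift (((fun z : Site P j => z.shift ν)^[s] ((fun z : Site P j => z.shift c.dir)^[t] (Site.blockSite c.src r)))) ν, c.dir⟩ * star ((V ⟨((fun z : Site P j => z.shift ν)^[s] ((fun z : Site P j => z.shift c.dir)^[t] (Site.blockSite c.src r))), ν⟩ : Matrix.specialUnitaryGroup n ℂ) : Matrix n n ℂ) - Z ⟨((fun z : Site P j => z.shift ν)^[s] ((fun z : Site P j => z.shift c.dir)^[t] (Site.blockSite c.src r))), c.dir⟩)‖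
          + 2 * ((2 * (P.L : ℝ)) ^ 2 * a') * ‖Z ⟨((fun z : Site P j => z.shift c.dir)^[t] ((fun z : Site P j => z.shift ν)^[P.L] (Site.blockSite c.src r))), c.dir⟩‖) := by
    rw [Prop7LineOfTransportedFamily.covWalkSum_walk_replicate_true, Prop7LineOfTransportedFamily.covWalkSum_walk_replicate_true,
      Finset.mul_sum, Finset.sum_mul, ← Finset.sum_sub_distrib]
    refine (norm_sum_le _ _).trans (Finset.sum_le_sum fun t ht => ?_)
    have htL : t < P.L := Finset.mem_range.mp ht
    -- per line bond: rectangle + telescope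
    have hrect := norm_ad_rect_sub_le V ha' hV (Site.blockSite c.src r) c.dir ν t P.L (Z ⟨((fun z : Site P j => z.shift c.dir)^[t] ((fun z : Site P j => z.shift ν)^[P.L] (Site.blockSite c.src r))), c.dir⟩)
    have htel := norm_transport_sub_le_sum_grad V Z ((fun z : Site P j => z.shift c.dir)^[t] (Site.blockSite c.src r)) c.dir ν P.L
    rw [← iterate_shift_comm (Site.blockSite c.src r) c.dir ν t P.L] at htel
    have hLt : ((P.L : ℝ) + t) ^ 2 * a' ≤ (2 * (P.L : ℝ)) ^ 2 * a' := by
      have : (t : ℝ) ≤ P.L := by exact_mod_cast htL.le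
      exact mul_le_mul_of_nonneg_right (by nlinarith) ha'
    have e : (((holAt V (walk (Site.blockSite c.src r) (List.replicate P.L (ν, true)))) : Matrix.specialUnitaryGroup n ℂ) : Matrix n n ℂ) * (((holAt V (walk ((fun z : Site P j => z.shift ν)^[P.L] (Site.blockSite c.src r)) (List.replicate t (c.dir, true))) : Matrix.specialUnitaryGroup n ℂ) : Matrix n n ℂ) * Z ⟨((fun z : Site P j => z.shift c.dir)^[t] ((fun z : Site P j => z.shift ν)^[P.L] (Site.blockSite c.src r))), c.dir⟩
          * star ((holAt V (walk ((fun z : Site P j => z.shift ν)^[P.L] (Site.blockSite c.src r)) (List.replicate t (c.dir, true))) : Matrix.specialUnitaryGroup n ℂ) : Matrix n n ℂ)) * star (((holAt V (walk (Site.blockSite c.src r) (List.replicate P.L (ν, true)))) : Matrix.specialUnitaryGroup n ℂ) : Matrix n n ℂ)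
        - ((holAt V (walk (Site.blockSite c.src r) (List.replicate t (c.dir, true))) : Matrix.specialUnitaryGroup n ℂ) : Matrix n n ℂ) * Z ⟨((fun z : Site P j => z.shift c.dir)^[t] (Site.blockSite c.src r)), c.dir⟩ * star ((holAt V (walk (Site.blockSite c.src r) (List.replicate t (c.dir, true))) : Matrix.specialUnitaryGroup n ℂ) : Matrix n n ℂ)
        = ((((holAt V (walk (Site.blockSite c.src r) (List.replicate P.L (ν, true)))) * holAt V (walk ((fun z : Site P j => z.shift ν)^[P.L] (Site.blockSite c.src r)) (List.replicate t (c.dir, true))) : Matrix.specialUnitaryGroup n ℂ) : Matrix n n ℂ) * Z ⟨((fun z : Site P j => z.shift c.dir)^[t] ((fun z : Site P j => z.shift ν)^[P.L] (Site.blockSite c.src r))), c.dir⟩ * star (((holAt V (walk (Site.blockSite c.src r) (List.replicate P.L (ν, true)))) * holAt V (walk ((fun z : Site P j => z.shift ν)^[P.L] (Site.blockSite c.src r)) (List.replicate t (c.dir, true))) : Matrix.specialUnitaryGroup n ℂ) : Matrix n n ℂ)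
            - ((holAt V (walk (Site.blockSite c.src r) (List.replicate t (c.dir, true))) * holAt V (walk ((fun z : Site P j => z.shift c.dir)^[t] (Site.blockSite c.src r)) (List.replicate P.L (ν, true))) : Matrix.specialUnitaryGroup n ℂ) : Matrix n n ℂ) * Z ⟨((fun z : Site P j => z.shift c.dir)^[t] ((fun z : Site P j => z.shift ν)^[P.L] (Site.blockSite c.src r))), c.dir⟩ * star ((holAt V (walk (Site.blockSite c.src r) (List.replicate t (c.dir, true))) * holAt V (walk ((fun z : Site P j => z.shift c.dir)^[t] (Site.blockSite c.src r)) (List.replicate P.L (ν, true))) : Matrix.specialUnitaryGroup n ℂ) : Matrix n n ℂ))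
          + ((holAt V (walk (Site.blockSite c.src r) (List.replicate t (c.dir, true))) : Matrix.specialUnitaryGroup n ℂ) : Matrix n n ℂ) * (((holAt V (walk ((fun z : Site P j => z.shift c.dir)^[t] (Site.blockSite c.src r)) (List.replicate P.L (ν, true))) : Matrix.specialUnitaryGroup n ℂ) : Matrix n n ℂ) * Z ⟨((fun z : Site P j => z.shift c.dir)^[t] ((fun z : Site P j => z.shift ν)^[P.L] (Site.blockSite c.src r))), c.dir⟩ * star ((holAt V (walk ((fun z : Site P j => z.shift c.dir)^[t] (Site.blockSite c.src r)) (List.replicate P.L (ν, true))) : Matrix.specialUnitaryGroup n ℂ) : Matrix n n ℂ)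
            - Z ⟨((fun z : Site P j => z.shift c.dir)^[t] (Site.blockSite c.src r)), c.dir⟩) * star ((holAt V (walk (Site.blockSite c.src r) (List.replicate t (c.dir, true))) : Matrix.specialUnitaryGroup n ℂ) : Matrix n n ℂ) := by
      rw [Submonoid.coe_mul, Submonoid.coe_mul, star_mul, star_mul]; noncomm_ring
    rw [e]
    calc _ ≤ ‖(((holAt V (walk (Site.blockSite c.src r) (List.replicate P.L (ν, true)))) * holAt V (walk ((fun z : Site P j => z.shift ν)^[P.L] (Site.blockSite c.src r)) (List.replicate t (c.dir, true))) : Matrix.specialUnitaryGroup n ℂ) : Matrix n n ℂ) * Z ⟨((fun z : Site P j => z.shift c.dir)^[t] ((fun z : Site P j => z.shift ν)^[P.L] (Site.blockSite c.src r))), c.dir⟩ * star (((holAt V (walk (Site.blockSite c.src r) (List.replicate P.L (ν, true)))) * holAt V (walk ((fun z : Site P j => z.shift ν)^[P.L] (Site.blockSite c.src r)) (List.replicate t (c.dir, true))) : Matrix.specialUnitaryGroup n ℂ) : Matrix n n ℂ)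
            - ((holAt V (walk (Site.blockSite c.src r) (List.replicate t (c.dir, true))) * holAt V (walk ((fun z : Site P j => z.shift c.dir)^[t] (Site.blockSite c.src r)) (List.replicate P.L (ν, true))) : Matrix.specialUnitaryGroup n ℂ) : Matrix n n ℂ) * Z ⟨((fun z : Site P j => z.shift c.dir)^[t] ((fun z : Site P j => z.shift ν)^[P.L] (Site.blockSite c.src r))), c.dir⟩ * star ((holAt V (walk (Site.blockSite c.src r) (List.replicate t (c.dir, true))) * holAt V (walk ((fun z : Site P j => z.shift c.dir)^[t] (Site.blockSite c.src r)) (List.replicate P.L (ν, true))) : Matrix.specialUnitaryGroup n ℂ) : Matrix n n ℂ)‖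
          + ‖((holAt V (walk (Site.blockSite c.src r) (List.replicate t (c.dir, true))) : Matrix.specialUnitaryGroup n ℂ) : Matrix n n ℂ) * (((holAt V (walk ((fun z : Site P j => z.shift c.dir)^[t] (Site.blockSite c.src r)) (List.replicate P.L (ν, true))) : Matrix.specialUnitaryGroup n ℂ) : Matrix n n ℂ) * Z ⟨((fun z : Site P j => z.shift c.dir)^[t] ((fun z : Site P j => z.shift ν)^[P.L] (Site.blockSite c.src r))), c.dir⟩ * star ((holAt V (walk ((fun z : Site P j => z.shift c.dir)^[t] (Site.blockSite c.src r)) (List.replicate P.L (ν, true))) : Matrix.specialUnitaryGroup n ℂ) : Matrix n n ℂ)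
            - Z ⟨((fun z : Site P j => z.shift c.dir)^[t] (Site.blockSite c.src r)), c.dir⟩) * star ((holAt V (walk (Site.blockSite c.src r) (List.replicate t (c.dir, true))) : Matrix.specialUnitaryGroup n ℂ) : Matrix n n ℂ)‖ := norm_add_le _ _
      _ ≤ 2 * (((P.L : ℝ) + t) ^ 2 * a') * ‖Z ⟨((fun z : Site P j => z.shift c.dir)^[t] ((fun z : Site P j => z.shift ν)^[P.L] (Site.blockSite c.src r))), c.dir⟩‖
          + ‖((holAt V (walk ((fun z : Site P j => z.shift c.dir)^[t] (Site.blockSite c.src r)) (List.replicate P.L (ν, true))) : Matrix.specialUnitaryGroup n ℂ) : Matrix n n ℂ) * Z ⟨((fun z : Site P j => z.shift c.dir)^[t] ((fun z : Site P j => z.shift ν)^[P.L] (Site.blockSite c.src r))), c.dir⟩ * star ((holAt V (walk ((fun z : Site P j => z.shift c.dir)^[t] (Site.blockSite c.src r)) (List.replicate P.L (ν, true))) : Matrix.specialUnitaryGroup n ℂ) : Matrix n n ℂ)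
            - Z ⟨((fun z : Site P j => z.shift c.dir)^[t] (Site.blockSite c.src r)), c.dir⟩‖ := add_le_add hrect (norm_conj_su_le _ _)
      _ ≤ 2 * ((2 * (P.L : ℝ)) ^ 2 * a') * ‖Z ⟨((fun z : Site P j => z.shift c.dir)^[t] ((fun z : Site P j => z.shift ν)^[P.L] (Site.blockSite c.src r))), c.dir⟩‖
          + ∑ s ∈ Finset.range P.L, ‖(((V ⟨((fun z : Site P j => z.shift ν)^[s] ((fun z : Site P j => z.shift c.dir)^[t] (Site.blockSite c.src r))), ν⟩ : Matrix.specialUnitaryGroup n ℂ) : Matrix n n ℂ) * Z ⟨Site.shift (((fun z : Site P j => z.shift ν)^[s] ((fun z : Site P j => z.shift c.dir)^[t] (Site.blockSite c.src r)))) ν, c.dir⟩ * star ((V ⟨((fun z : Site P j => z.shift ν)^[s] ((fun z : Site P j => z.shift c.dir)^[t] (Site.blockSite c.src r))), ν⟩ : Matrix.specialUnitaryGroup n ℂ) : Matrix n n ℂ) - Z ⟨((fun z : Site P j => z.shift ν)^[s] ((fun z : Site P j => z.shift c.dir)^[t] (Site.blockSite c.src r))), c.dir⟩)‖ :=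
          add_le_add (mul_le_mul_of_nonneg_right (mul_le_mul_of_nonneg_left hLt (by norm_num)) (norm_nonneg _)) htel
      _ = _ := by ring
  -- assembly: the three re-routings and the main term
  have hsplit : ((avgFun (expMeanLogSU (n := n)) V ⟨c.src, ν⟩ : Matrix.specialUnitaryGroup n ℂ) : Matrix n n ℂ) * ((((holAt V (walk (emb (c.src.shift ν)) (stairWord σ (off r)))) : Matrix.specialUnitaryGroup n ℂ) : Matrix n n ℂ) * (covWalkSum V Z (walk ((fun z : Site P j => z.shift ν)^[P.L] (Site.blockSite c.src r)) (List.replicate P.L (c.dir, true)))) * star (((holAt V (walk (emb (c.src.shift ν)) (stairWord σ (off r)))) : Matrix.specialUnitaryGroup n ℂ) : Matrix n n ℂ)) * star ((avgFun (expMeanLogSU (n := n)) V ⟨c.src, ν⟩ : Matrix.specialUnitaryGroup n ℂ) : Matrix n n ℂ) - (((holAt V (walk (emb c.src) (stairWord σ (off r)))) : Matrix.specialUnitaryGroup n ℂ) : Matrix n n ℂ) * (covWalkSum V Z (walk (Site.blockSite c.src r) (List.replicate P.L (c.dir, true)))) * star (((holAt V (walk (emb c.src) (stairWord σ (off r))))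 : Matrix.specialUnitaryGroup n ℂ) : Matrix n n ℂ)
      = (((avgFun (expMeanLogSU (n := n)) V ⟨c.src, ν⟩ : Matrix.specialUnitaryGroup n ℂ) : Matrix n n ℂ) * ((((holAt V (walk (emb (c.src.shift ν)) (stairWord σ (off r)))) : Matrix.specialUnitaryGroup n ℂ) : Matrix n n ℂ) * (covWalkSum V Z (walk ((fun z : Site P j => z.shift ν)^[P.L] (Site.blockSite c.src r)) (List.replicate P.L (c.dir, true)))) * star (((holAt V (walk (emb (c.src.shift ν)) (stairWord σ (off r)))) : Matrix.specialUnitaryGroup n ℂ) : Matrix n n ℂ)) * star ((avgFun (expMeanLogSU (n := n)) V ⟨c.src, ν⟩ : Matrix.specialUnitaryGroup n ℂ) : Matrix n n ℂ)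
          - (((holAt V (walk (emb c.src) (List.replicate P.L (ν, true)))) : Matrix.specialUnitaryGroup n ℂ) : Matrix n n ℂ) * ((((holAt V (walk (emb (c.src.shift ν)) (stairWord σ (off r)))) : Matrix.specialUnitaryGroup n ℂ) : Matrix n n ℂ) * (covWalkSum V Z (walk ((fun z : Site P j => z.shift ν)^[P.L] (Site.blockSite c.src r)) (List.replicate P.L (c.dir, true)))) * star (((holAt V (walk (emb (c.src.shift ν)) (stairWord σ (off r)))) : Matrix.specialUnitaryGroup n ℂ) : Matrix n n ℂ)) * star (((holAt V (walk (emb c.src) (List.replicate P.L (ν, true)))) : Matrix.specialUnitaryGroup n ℂ) : Matrix n n ℂ))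
        + ((((holAt V (walk (emb c.src) (List.replicate P.L (ν, true)))) : Matrix.specialUnitaryGroup n ℂ) : Matrix n n ℂ) * ((((holAt V (walk (emb (c.src.shift ν)) (stairWord σ (off r)))) : Matrix.specialUnitaryGroup n ℂ) : Matrix n n ℂ) * (covWalkSum V Z (walk ((fun z : Site P j => z.shift ν)^[P.L] (Site.blockSite c.src r)) (List.replicate P.L (c.dir, true)))) * star (((holAt V (walk (emb (c.src.shift ν)) (stairWord σ (off r)))) : Matrix.specialUnitaryGroup n ℂ) : Matrix n n ℂ)) * star (((holAt V (walk (emb c.src) (List.replicate P.L (ν, true)))) : Matrix.specialUnitaryGroup n ℂ) : Matrix n n ℂ)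
          - (((holAt V (walk (emb c.src) (stairWord σ (off r)))) : Matrix.specialUnitaryGroup n ℂ) : Matrix n n ℂ) * ((((holAt V (walk (Site.blockSite c.src r) (List.replicate P.L (ν, true)))) : Matrix.specialUnitaryGroup n ℂ) : Matrix n n ℂ) * (covWalkSum V Z (walk ((fun z : Site P j => z.shift ν)^[P.L] (Site.blockSite c.src r)) (List.replicate P.L (c.dir, true)))) * star (((holAt V (walk (Site.blockSite c.src r) (List.replicate P.L (ν, true)))) : Matrix.specialUnitaryGroup n ℂ) : Matrix n n ℂ)) * star (((holAt V (walk (emb c.src) (stairWord σ (off r)))) : Matrix.specialUnitaryGroup n ℂ) : Matrix n n ℂ))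
        + (((holAt V (walk (emb c.src) (stairWord σ (off r)))) : Matrix.specialUnitaryGroup n ℂ) : Matrix n n ℂ) * ((((holAt V (walk (Site.blockSite c.src r) (List.replicate P.L (ν, true)))) : Matrix.specialUnitaryGroup n ℂ) : Matrix n n ℂ) * (covWalkSum V Z (walk ((fun z : Site P j => z.shift ν)^[P.L] (Site.blockSite c.src r)) (List.replicate P.L (c.dir, true)))) * star (((holAt V (walk (Site.blockSite c.src r) (List.replicate P.L (ν, true)))) : Matrix.specialUnitaryGroup n ℂ) : Matrix n n ℂ) - (covWalkSum V Z (walk (Site.blockSite c.src r) (List.replicate P.L (c.dir, true))))) * star (((holAt V (walk (emb c.src) (stairWord σ (off r)))) : Matrix.specialUnitaryGroup n ℂ) : Matrix n n ℂ) := by noncomm_ring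
  rw [hsplit]
  have h3' : ‖(((holAt V (walk (emb c.src) (stairWord σ (off r)))) : Matrix.specialUnitaryGroup n ℂ) : Matrix n n ℂ) * ((((holAt V (walk (Site.blockSite c.src r) (List.replicate P.L (ν, true)))) : Matrix.specialUnitaryGroup n ℂ) : Matrix n n ℂ) * (covWalkSum V Z (walk ((fun z : Site P j => z.shift ν)^[P.L] (Site.blockSite c.src r)) (List.replicate P.L (c.dir, true)))) * star (((holAt V (walk (Site.blockSite c.src r) (List.replicate P.L (ν, true)))) : Matrix.specialUnitaryGroup n ℂ) : Matrix n n ℂ) - (covWalkSum V Z (walk (Site.blockSite c.src r) (List.replicate P.L (c.dir, true))))) * star (((holAt V (walk (emb c.src) (stairWord σ (off r)))) : Matrix.specialUnitaryGroup n ℂ) : Matrix n n ℂ)‖ ≤ ‖(((holAt V (walk (Site.blockSite c.src r) (List.replicate P.L (ν, true)))) : Matrix.specialUnitaryGroup n ℂ) : Matrix n n ℂ) * (covWalkSum V Z (walk ((fun z : Site P j => z.shift ν)^[P.L] (Site.blockSite c.src r)) (List.replicate P.L (c.dir, true)))) * star (((holAt V (walk (Site.blockSite c.src r) (List.replicate P.L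 (ν, true)))) : Matrix.specialUnitaryGroup n ℂ) : Matrix n n ℂ) - (covWalkSum V Z (walk (Site.blockSite c.src r) (List.replicate P.L (c.dir, true))))‖ := norm_conj_su_le _ _
  have hsum3 : ∑ t ∈ Finset.range P.L, (∑ s ∈ Finset.range P.L, ‖(((V ⟨((fun z : Site P j => z.shift ν)^[s] ((fun z : Site P j => z.shift c.dir)^[t] (Site.blockSite c.src r))), ν⟩ : Matrix.specialUnitaryGroup n ℂ) : Matrix n n ℂ) * Z ⟨Site.shift (((fun z : Site P j => z.shift ν)^[s] ((fun z : Site P j => z.shift c.dir)^[t] (Site.blockSite c.src r)))) ν, c.dir⟩ * star ((V ⟨((fun z : Site P j => z.shift ν)^[s] ((fun z : Site P j => z.shift c.dir)^[t] (Site.blockSite c.src r))), ν⟩ : Matrix.specialUnitaryGroup n ℂ) : Matrix n n ℂ) - Z ⟨((fun z : Site P j => z.shift ν)^[s] ((fun z : Site P j => z.shift c.dir)^[t] (Site.blockSite c.src r))), c.dir⟩)‖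
          + 2 * ((2 * (P.L : ℝ)) ^ 2 * a') * ‖Z ⟨((fun z : Site P j => z.shift c.dir)^[t] ((fun z : Site P j => z.shift ν)^[P.L] (Site.blockSite c.src r))), c.dir⟩‖)
      = ∑ t ∈ Finset.range P.L, ∑ s ∈ Finset.range P.L, ‖(((V ⟨((fun z : Site P j => z.shift ν)^[s] ((fun z : Site P j => z.shift c.dir)^[t] (Site.blockSite c.src r))), ν⟩ : Matrix.specialUnitaryGroup n ℂ) : Matrix n n ℂ) * Z ⟨Site.shift (((fun z : Site P j => z.shift ν)^[s] ((fun z : Site P j => z.shift c.dir)^[t] (Site.blockSite c.src r)))) ν, c.dir⟩ * star ((V ⟨((fun z : Site P j => z.shift ν)^[s] ((fun z : Site P j => z.shift c.dir)^[t] (Site.blockSite c.src r))), ν⟩ : Matrix.specialUnitaryGroup n ℂ) : Matrix n n ℂ) - Z ⟨((fun z : Site P j => z.shift ν)^[s] ((fun z : Site P j => z.shift c.dir)^[t] (Site.blockSite c.src r))), c.dir⟩)‖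
        + 8 * (P.L : ℝ) ^ 2 * a' * ∑ t ∈ Finset.range P.L, ‖Z ⟨((fun z : Site P j => z.shift c.dir)^[t] ((fun z : Site P j => z.shift ν)^[P.L] (Site.blockSite c.src r))), c.dir⟩‖ := by
    rw [Finset.sum_add_distrib, ← Finset.mul_sum]; ring
  calc _ ≤ ‖((avgFun (expMeanLogSU (n := n)) V ⟨c.src, ν⟩ : Matrix.specialUnitaryGroup n ℂ) : Matrix n n ℂ) * ((((holAt V (walk (emb (c.src.shift ν)) (stairWord σ (off r)))) : Matrix.specialUnitaryGroup n ℂ) : Matrix n n ℂ) * (covWalkSum V Z (walk ((fun z : Site P j => z.shift ν)^[P.L] (Site.blockSite c.src r)) (List.replicate P.L (c.dir, true)))) * star (((holAt V (walk (emb (c.src.shift ν)) (stairWord σ (off r)))) : Matrix.specialUnitaryGroup n ℂ) : Matrix n n ℂ)) * star ((avgFun (expMeanLogSU (n := n)) V ⟨c.src, ν⟩ : Matrix.specialUnitaryGroup n ℂ) : Matrix n n ℂ)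
          - (((holAt V (walk (emb c.src) (List.replicate P.L (ν, true)))) : Matrix.specialUnitaryGroup n ℂ) : Matrix n n ℂ) * ((((holAt V (walk (emb (c.src.shift ν)) (stairWord σ (off r)))) : Matrix.specialUnitaryGroup n ℂ) : Matrix n n ℂ) * (covWalkSum V Z (walk ((fun z : Site P j => z.shift ν)^[P.L] (Site.blockSite c.src r)) (List.replicate P.L (c.dir, true)))) * star (((holAt V (walk (emb (c.src.shift ν)) (stairWord σ (off r)))) : Matrix.specialUnitaryGroup n ℂ) : Matrix n n ℂ)) * star (((holAt V (walk (emb c.src) (List.replicate P.L (ν, true)))) : Matrix.specialUnitaryGroup n ℂ) : Matrix n n ℂ)‖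
        + ‖(((holAt V (walk (emb c.src) (List.replicate P.L (ν, true)))) : Matrix.specialUnitaryGroup n ℂ) : Matrix n n ℂ) * ((((holAt V (walk (emb (c.src.shift ν)) (stairWord σ (off r)))) : Matrix.specialUnitaryGroup n ℂ) : Matrix n n ℂ) * (covWalkSum V Z (walk ((fun z : Site P j => z.shift ν)^[P.L] (Site.blockSite c.src r)) (List.replicate P.L (c.dir, true)))) * star (((holAt V (walk (emb (c.src.shift ν)) (stairWord σ (off r)))) : Matrix.specialUnitaryGroup n ℂ) : Matrix n n ℂ)) * star (((holAt V (walk (emb c.src) (List.replicate P.L (ν, true)))) : Matrix.specialUnitaryGroup n ℂ) : Matrix n n ℂ)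
          - (((holAt V (walk (emb c.src) (stairWord σ (off r)))) : Matrix.specialUnitaryGroup n ℂ) : Matrix n n ℂ) * ((((holAt V (walk (Site.blockSite c.src r) (List.replicate P.L (ν, true)))) : Matrix.specialUnitaryGroup n ℂ) : Matrix n n ℂ) * (covWalkSum V Z (walk ((fun z : Site P j => z.shift ν)^[P.L] (Site.blockSite c.src r)) (List.replicate P.L (c.dir, true)))) * star (((holAt V (walk (Site.blockSite c.src r) (List.replicate P.L (ν, true)))) : Matrix.specialUnitaryGroup n ℂ) : Matrix n n ℂ)) * star (((holAt V (walk (emb c.src) (stairWord σ (off r)))) : Matrix.specialUnitaryGroup n ℂ) : Matrix n n ℂ)‖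
        + ‖(((holAt V (walk (emb c.src) (stairWord σ (off r)))) : Matrix.specialUnitaryGroup n ℂ) : Matrix n n ℂ) * ((((holAt V (walk (Site.blockSite c.src r) (List.replicate P.L (ν, true)))) : Matrix.specialUnitaryGroup n ℂ) : Matrix n n ℂ) * (covWalkSum V Z (walk ((fun z : Site P j => z.shift ν)^[P.L] (Site.blockSite c.src r)) (List.replicate P.L (c.dir, true)))) * star (((holAt V (walk (Site.blockSite c.src r) (List.replicate P.L (ν, true)))) : Matrix.specialUnitaryGroup n ℂ) : Matrix n n ℂ) - (covWalkSum V Z (walk (Site.blockSite c.src r) (List.replicate P.L (c.dir, true))))) * star (((holAt V (walk (emb c.src) (stairWord σ (off r)))) : Matrix.specialUnitaryGroup n ℂ) : Matrix n n ℂ)‖ :=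
        (norm_add_le _ _).trans (add_le_add (norm_add_le _ _) le_rfl)
    _ ≤ 2 * (2 * a) * ‖(covWalkSum V Z (walk ((fun z : Site P j => z.shift ν)^[P.L] (Site.blockSite c.src r)) (List.replicate P.L (c.dir, true))))‖ + 2 * a * ‖(covWalkSum V Z (walk ((fun z : Site P j => z.shift ν)^[P.L] (Site.blockSite c.src r)) (List.replicate P.L (c.dir, true))))‖ + ‖(((holAt V (walk (Site.blockSite c.src r) (List.replicate P.L (ν, true)))) : Matrix.specialUnitaryGroup n ℂ) : Matrix n n ℂ) * (covWalkSum V Z (walk ((fun z : Site P j => z.shift ν)^[P.L] (Site.blockSite c.src r)) (List.replicate P.L (c.dir, true)))) * star (((holAt V (walk (Site.blockSite c.src r) (List.replicate P.L (ν, true)))) : Matrix.specialUnitaryGroup n ℂ) : Matrix n n ℂ) - (covWalkSum V Z (walk (Site.blockSite c.src r) (List.replicate P.L (c.dir, true))))‖ := add_le_add (add_le_add h1 h2) h3'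
    _ ≤ 2 * (2 * a) * (∑ t ∈ Finset.range P.L, ‖Z ⟨((fun z : Site P j => z.shift c.dir)^[t] ((fun z : Site P j => z.shift ν)^[P.L] (Site.blockSite c.src r))), c.dir⟩‖)
        + 2 * a * (∑ t ∈ Finset.range P.L, ‖Z ⟨((fun z : Site P j => z.shift c.dir)^[t] ((fun z : Site P j => z.shift ν)^[P.L] (Site.blockSite c.src r))), c.dir⟩‖)
        + (∑ t ∈ Finset.range P.L, ∑ s ∈ Finset.range P.L, ‖(((V ⟨((fun z : Site P j => z.shift ν)^[s] ((fun z : Site P j => z.shift c.dir)^[t] (Site.blockSite c.src r))), ν⟩ : Matrix.specialUnitaryGroup n ℂ) : Matrix n n ℂ) * Z ⟨Site.shift (((fun z : Site P j => z.shift ν)^[s] ((fun z : Site P j => z.shift c.dir)^[t] (Site.blockSite c.src r)))) ν, c.dir⟩ * star ((V ⟨((fun z : Site P j => z.shift ν)^[s] ((fun z : Site P j => z.shift c.dir)^[t] (Site.blockSite c.src r))), ν⟩ : Matrix.specialUnitaryGroup n ℂ) : Matrix n n ℂ) - Z ⟨((fun z : Site P j => z.shift ν)^[s] ((fun z : Site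 P j => z.shift c.dir)^[t] (Site.blockSite c.src r))), c.dir⟩)‖
          + 8 * (P.L : ℝ) ^ 2 * a' * ∑ t ∈ Finset.range P.L, ‖Z ⟨((fun z : Site P j => z.shift c.dir)^[t] ((fun z : Site P j => z.shift ν)^[P.L] (Site.blockSite c.src r))), c.dir⟩‖) :=
        add_le_add (add_le_add (mul_le_mul_of_nonneg_left hmassS' (by positivity)) (mul_le_mul_of_nonneg_left hmassS' (by positivity)))
          (h3.trans (le_of_eq hsum3))
    _ = _ := by ring

end Summit.QuantumFields.YangMills.Theorems.Prop7LineMeanOscLetters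

end
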